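import Summits.CriticalPhenomena.PercolationContinuityZ3.Theorems.PercNearOneGluingNoHeavyQuantHalfMeanSmallBall
import HarnessLib

/-!
# QUANT lane R8 tool: the Poisson ratio bound for sums of independent Bernoulli gates
# (`b·P(X = b) ≥ μ·P(X = b−1)` for `b ≤ μ`) and "the atom beats the tail" (`P(X ≤ k) ≤ P(X = k+1)` for `μ ≥ 2k+1`)

builds on p205010 (kernel theorem, internal audit signed; external expert review pending)

Support file (`--supports stmt-CriticalPhenomena-4575`), QUANT lane typer seat prim-quant-stmt (gen 10); memo
`run/shared/lean/prim/quant/prim-quant-stmt-g10/TLB-NOTES.md` §7.  Theorems only; no definitions, no sorries, standard axioms.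

For independent gates `p : ι → [0,1]` (`prodBernoulli p` on `Set ι`, `ι` finite) and a finset `L` of coordinates let
`N_L(s) = #{i ∈ L | i ∈ s}` (a Poisson-binomial variable) and `U_L = Σ_{i∈L} p_i = E N_L`.

* `Quant.pb_count_succ_split` / `Quant.pb_count_zero_split` — conditioning on one gate `i ∈ L`:
  `P(N_L = b+1) = p_i·P(N_{L∖i} = b) + (1−p_i)·P(N_{L∖i} = b+1)`, `P(N_L = 0) = (1−p_i)·P(N_{L∖i} = 0)`.
* `Quant.pb_sizeBias` — size-biasing: `(b+1)·P(N_L = b+1) = Σ_{i∈L} p_i·P(N_{L∖i} = b)`.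
* `Quant.pb_ratio` — **the Poisson ratio bound**: `U_L·P(N_L = b−1) ≤ b·P(N_L = b)` for every integer `1 ≤ b ≤ U_L`
  (for the Poisson law this is an equality for every `b`; for the binomial it is `b − 1 ≤ nu`).  Proof by strong induction on `L`:
  `b·P_L(b) − U_L·P_L(b−1) = Σ_{i∈L} p_i²·(P_{L∖i}(b−1) − P_{L∖i}(b−2)) ≥ 0`, the bracket being nonnegative by the induction
  hypothesis for `L ∖ i` at level `b−1 ≤ U_{L∖i}` (which makes the pmf nondecreasing up to the mean).
* `Quant.pb_tail_le_atom_aux` — `(U_L − b)·P(N_L ≤ b) ≤ U_L·P(N_L = b)` for `b ≤ U_L` (induction on `b`).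
* `Quant.pb_tail_le_atom` — **the atom beats the tail**: if `2k + 1 ≤ U_L` then `P(N_L ≤ k) ≤ P(N_L = k+1)`
  (tight for Poisson(`2k+1`) as `k → ∞`).  This is the anti-concentration input of the two-level inequality for FAR on trees
  (memo §5–§7: it closes the light-block case `a < j` of the loose-hub family).
Nearest prior art searched (corpus hybrid + galaxy: "ultra log-concave", "Poisson binomial", ratio of consecutive probabilities; Newton's
inequalities, Darroch 1964 / Samuels 1965 on the mode of the Poisson binomial): the monotonicity of `b·p_b/p_{b−1}` (ultra-log-concavity) is
classical, the bound by the MEAN in this form was not found; recorded as [this work] with [folklore] size-biasing.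
-/

noncomputable section

namespace Summit.CriticalPhenomena.PercolationContinuityZ3.Theorems

open MeasureTheory Finset
open Literature.Probability.LatticeModels
open Literature.Probability.Percolation
open Literature.Probability.Percolation.BHK2006 (weight weight_nonneg)
open Literature.Probability.Percolation.DecisionTree (ind ind_of_mem ind_of_not_mem ind_nonneg)
open scoped Classical

namespace Quant

variable {ι : Type*} [Fintype ι]

/-! ### Conditioning the count on one gate -/

omit [Fintype ι] in
/-- The count event is determined by the counted coordinates. [folklore] -/
theorem pb_determinedBy_count (L : Finset ι) (Φ : ℕ → Prop) :
    DeterminedBy {s : Set ι | Φ (L.filter fun i => i ∈ s).card} (↑L : Set ι) := by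
  rw [determinedBy_iff]
  intro ω ω' h
  have : (L.filter fun x => x ∈ ω) = (L.filter fun x => x ∈ ω') := by
    ext x
    simp only [Finset.mem_filter, and_congr_right_iff]
    intro hx
    have h1 : x ∈ ω ∩ (↑L : Set ι) ↔ x ∈ ω' ∩ (↑L : Set ι) := by rw [h]
    simpa [hx] using h1
  simp only [Set.mem_setOf_eq, this]

omit [Fintype ι] in
/-- Removing a counted coordinate: if `i ∈ L` and `i ∈ s` then `N_L(s) = N_{L∖i}(s) + 1`, and if `i ∉ s` then `N_L(s) = N_{L∖i}(s)`.
[folklore] -/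
theorem pb_count_erase (L : Finset ι) {i : ι} (hi : i ∈ L) (s : Set ι) :
    (L.filter fun x => x ∈ s).card =
      ((L.erase i).filter fun x => x ∈ s).card + (if i ∈ s then 1 else 0) := by
  have hL : L = insert i (L.erase i) := (Finset.insert_erase hi).symm
  conv_lhs => rw [hL]
  rw [Finset.filter_insert]
  by_cases his : i ∈ s
  · rw [if_pos his, if_pos his, Finset.card_insert_of_notMem]
    intro h
    exact (Finset.notMem_erase i L) (Finset.mem_filter.1 h).1
  · rw [if_neg his, if_neg his, add_zero]

/-- **One-gate split of the count law, positive level**: for `i ∈ L`,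
`P(N_L = b+1) = p_i·P(N_{L∖i} = b) + (1 − p_i)·P(N_{L∖i} = b+1)`. [folklore] -/
theorem pb_count_succ_split (p : ι → unitInterval) (L : Finset ι) {i : ι} (hi : i ∈ L) (b : ℕ) :
    (prodBernoulli p).real {s : Set ι | (L.filter fun x => x ∈ s).card = b + 1} =
      (p i : ℝ) * (prodBernoulli p).real {s : Set ι | ((L.erase i).filter fun x => x ∈ s).card = b} +
        (1 - (p i : ℝ)) * (prodBernoulli p).real {s : Set ι | ((L.erase i).filter fun x => x ∈ s).card = b + 1} := by
  set μ := prodBernoulli p with hμ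
  have hmeas : ∀ S : Set (Set ι), MeasurableSet S := fun S => MeasurableSet.of_discrete
  set E : Set (Set ι) := {s : Set ι | (L.filter fun x => x ∈ s).card = b + 1} with hE
  set A0 : Set (Set ι) := {s : Set ι | ((L.erase i).filter fun x => x ∈ s).card = b} with hA0
  set A1 : Set (Set ι) := {s : Set ι | ((L.erase i).filter fun x => x ∈ s).card = b + 1} with hA1
  set I : Set (Set ι) := {s : Set ι | i ∈ s} with hI
  have hsplit : μ.real E = μ.real (E ∩ I) + μ.real (E \ I) :=
    (measureReal_inter_add_sdiff (μ := μ) (s := E) (hmeas _)).symm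
  have h1 : E ∩ I = A0 ∩ I := by
    ext s
    simp only [hE, hA0, hI, Set.mem_inter_iff, Set.mem_setOf_eq]
    constructor
    · rintro ⟨h, his⟩
      have := pb_count_erase L hi s
      rw [if_pos his] at this
      exact ⟨by omega, his⟩
    · rintro ⟨h, his⟩
      have := pb_count_erase L hi s
      rw [if_pos his] at this
      exact ⟨by omega, his⟩
  have h2 : E \ I = A1 ∩ {s : Set ι | i ∉ s} := by
    ext s
    simp only [hE, hA1, hI, Set.mem_sdiff, Set.mem_inter_iff, Set.mem_setOf_eq]
    constructor
    · rintro ⟨h, his⟩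
      have := pb_count_erase L hi s
      rw [if_neg his] at this
      exact ⟨by omega, his⟩
    · rintro ⟨h, his⟩
      have := pb_count_erase L hi s
      rw [if_neg his] at this
      exact ⟨by omega, his⟩
  have hdisj : Disjoint (L.erase i) ({i} : Finset ι) := by
    rw [Finset.disjoint_singleton_right]; exact Finset.notMem_erase i L
  have hdetA0 : DeterminedBy A0 (↑(L.erase i) : Set ι) := pb_determinedBy_count (L.erase i) (fun m => m = b)
  have hdetA1 : DeterminedBy A1 (↑(L.erase i) : Set ι) := pb_determinedBy_count (L.erase i) (fun m => m = b + 1)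
  have hdetI : DeterminedBy I (↑({i} : Finset ι) : Set ι) := by
    rw [determinedBy_iff]
    intro ω ω' h
    have h' : i ∈ ω ∩ ↑({i} : Finset ι) ↔ i ∈ ω' ∩ ↑({i} : Finset ι) := by rw [h]
    simpa [hI] using h'
  have hdetIc : DeterminedBy {s : Set ι | i ∉ s} (↑({i} : Finset ι) : Set ι) := by
    rw [determinedBy_iff]
    intro ω ω' h
    have h' : i ∈ ω ∩ ↑({i} : Finset ι) ↔ i ∈ ω' ∩ ↑({i} : Finset ι) := by rw [h]
    simp only [Set.mem_inter_iff, Finset.coe_singleton, Set.mem_singleton_iff, and_true] at h'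
    simp only [Set.mem_setOf_eq, h']
  rw [hsplit, h1, h2,
    prodBernoulli_real_inter_of_determinedBy_disjoint p hdisj hdetA0 hdetI (hmeas _) (hmeas _),
    prodBernoulli_real_inter_of_determinedBy_disjoint p hdisj hdetA1 hdetIc (hmeas _) (hmeas _),
    prodBernoulli_real_setOf_mem, prodBernoulli_real_setOf_notMem]
  ring

/-- **One-gate split of the count law, level zero**: for `i ∈ L`, `P(N_L = 0) = (1 − p_i)·P(N_{L∖i} = 0)`. [folklore] -/
theorem pb_count_zero_split (p : ι → unitInterval) (L : Finset ι) {i : ι} (hi : i ∈ L) :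
    (prodBernoulli p).real {s : Set ι | (L.filter fun x => x ∈ s).card = 0} =
      (1 - (p i : ℝ)) * (prodBernoulli p).real {s : Set ι | ((L.erase i).filter fun x => x ∈ s).card = 0} := by
  have hmeas : ∀ S : Set (Set ι), MeasurableSet S := fun S => MeasurableSet.of_discrete
  have hset : {s : Set ι | (L.filter fun x => x ∈ s).card = 0} =
      {s : Set ι | ((L.erase i).filter fun x => x ∈ s).card = 0} ∩ {s : Set ι | i ∉ s} := by
    ext s
    simp only [Set.mem_inter_iff, Set.mem_setOf_eq]
    have := pb_count_erase L hi s
    constructor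
    · intro h
      by_cases his : i ∈ s
      · rw [if_pos his] at this; omega
      · rw [if_neg his] at this; exact ⟨by omega, his⟩
    · rintro ⟨h, his⟩
      rw [if_neg his] at this; omega
  have hdisj : Disjoint (L.erase i) ({i} : Finset ι) := by
    rw [Finset.disjoint_singleton_right]; exact Finset.notMem_erase i L
  have hdet : DeterminedBy {s : Set ι | ((L.erase i).filter fun x => x ∈ s).card = 0} (↑(L.erase i) : Set ι) :=
    pb_determinedBy_count (L.erase i) (fun m => m = 0)
  have hdetIc : DeterminedBy {s : Set ι | i ∉ s} (↑({i} : Finset ι) : Set ι) := by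
    rw [determinedBy_iff]
    intro ω ω' h
    have h' : i ∈ ω ∩ ↑({i} : Finset ι) ↔ i ∈ ω' ∩ ↑({i} : Finset ι) := by rw [h]
    simp only [Set.mem_inter_iff, Finset.coe_singleton, Set.mem_singleton_iff, and_true] at h'
    simp only [Set.mem_setOf_eq, h']
  rw [hset, prodBernoulli_real_inter_of_determinedBy_disjoint p hdisj hdet hdetIc (hmeas _) (hmeas _),
    prodBernoulli_real_setOf_notMem, mul_comm]

/-- **Size-biasing the count**: `(b+1)·P(N_L = b+1) = Σ_{i∈L} p_i·P(N_{L∖i} = b)`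
(`E[N·1(N = b+1)] = Σ_{i∈L} P(i open, N = b+1)` and independence). [folklore] -/
theorem pb_sizeBias (p : ι → unitInterval) (L : Finset ι) (b : ℕ) :
    ((b : ℝ) + 1) * (prodBernoulli p).real {s : Set ι | (L.filter fun x => x ∈ s).card = b + 1} =
      ∑ i ∈ L, (p i : ℝ) * (prodBernoulli p).real {s : Set ι | ((L.erase i).filter fun x => x ∈ s).card = b} := by
  set μ := prodBernoulli p with hμ
  have hmeas : ∀ S : Set (Set ι), MeasurableSet S := fun S => MeasurableSet.of_discrete
  set E : Set (Set ι) := {s : Set ι | (L.filter fun x => x ∈ s).card = b + 1} with hE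
  set W : Set ι → ℝ := weight (fun e => (p e : ℝ)) with hW
  -- each summand is `P(N_L = b+1, i open)`
  have hterm : ∀ i ∈ L, (p i : ℝ) * μ.real {s : Set ι | ((L.erase i).filter fun x => x ∈ s).card = b} =
      μ.real (E ∩ {s : Set ι | i ∈ s}) := by
    intro i hi
    have h1 : E ∩ {s : Set ι | i ∈ s} = {s : Set ι | ((L.erase i).filter fun x => x ∈ s).card = b} ∩ {s : Set ι | i ∈ s} := by
      ext s
      simp only [hE, Set.mem_inter_iff, Set.mem_setOf_eq]
      have := pb_count_erase L hi s
      constructor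
      · rintro ⟨h, his⟩; rw [if_pos his] at this; exact ⟨by omega, his⟩
      · rintro ⟨h, his⟩; rw [if_pos his] at this; exact ⟨by omega, his⟩
    have hdisj : Disjoint (L.erase i) ({i} : Finset ι) := by
      rw [Finset.disjoint_singleton_right]; exact Finset.notMem_erase i L
    have hdet := pb_determinedBy_count (ι := ι) (L.erase i) (fun m => m = b)
    have hdetI : DeterminedBy {s : Set ι | i ∈ s} (↑({i} : Finset ι) : Set ι) := by
      rw [determinedBy_iff]
      intro ω ω' h
      have h' : i ∈ ω ∩ ↑({i} : Finset ι) ↔ i ∈ ω' ∩ ↑({i} : Finset ι) := by rw [h]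
      simpa using h'
    rw [h1, prodBernoulli_real_inter_of_determinedBy_disjoint p hdisj hdet hdetI (hmeas _) (hmeas _),
      prodBernoulli_real_setOf_mem, mul_comm]
  rw [Finset.sum_congr rfl hterm]
  -- `Σ_{i∈L} P(E, i open) = (b+1)·P(E)` by the weighted-sum representation
  simp_rw [hμ, prodBernoulli_real_eq_sum_weight_ind p]
  rw [Finset.sum_comm, Finset.mul_sum]
  refine Finset.sum_congr rfl fun s _ => ?_
  rw [← Finset.mul_sum]
  by_cases hs : s ∈ E
  · rw [ind_of_mem hs]
    have hcount : ∑ i ∈ L, ind (E ∩ {s' : Set ι | i ∈ s'}) s = (L.filter fun x => x ∈ s).card := by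
      rw [Finset.card_eq_sum_ones, Finset.sum_filter]
      push_cast
      refine Finset.sum_congr rfl fun i _ => ?_
      by_cases his : i ∈ s
      · rw [if_pos his, ind_of_mem (show s ∈ E ∩ {s' : Set ι | i ∈ s'} from ⟨hs, his⟩)]
      · rw [if_neg his, ind_of_not_mem (show s ∉ E ∩ {s' : Set ι | i ∈ s'} from fun h => his h.2)]
    rw [hcount]
    have hb : (L.filter fun x => x ∈ s).card = b + 1 := hs
    rw [hb]; push_cast; ring
  · rw [ind_of_not_mem hs]
    have : ∑ i ∈ L, ind (E ∩ {s' : Set ι | i ∈ s'}) s = 0 :=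
      Finset.sum_eq_zero fun i _ => ind_of_not_mem (show s ∉ E ∩ {s' : Set ι | i ∈ s'} from fun h => hs h.1)
    rw [this]; ring

/-- **The Poisson ratio bound for Poisson-binomial laws.**  For every finset `L` of independent gates and every integer `b` with
`1 ≤ b ≤ U_L = Σ_{i∈L} p_i`:  `U_L · P(N_L = b−1) ≤ b · P(N_L = b)`.  (Equality for the Poisson law; in particular the pmf of `N_L`
is nondecreasing on `[0, ⌊U_L⌋]`.)  Proof: strong induction on `L` through the size-bias identity, whose remainder
`Σ_i p_i²·(P_{L∖i}(b−1) − P_{L∖i}(b−2))` is nonnegative by the induction hypothesis. [this work] -/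
theorem pb_ratio (p : ι → unitInterval) (L : Finset ι) (b : ℕ) (hb1 : 1 ≤ b)
    (hbU : (b : ℝ) ≤ ∑ i ∈ L, (p i : ℝ)) :
    (∑ i ∈ L, (p i : ℝ)) * (prodBernoulli p).real {s : Set ι | (L.filter fun x => x ∈ s).card = b - 1} ≤
      (b : ℝ) * (prodBernoulli p).real {s : Set ι | (L.filter fun x => x ∈ s).card = b} := by
  induction L using Finset.strongInduction generalizing b with
  | H L ih =>
    set μ := prodBernoulli p with hμ
    have hp0 : ∀ i, (0 : ℝ) ≤ p i := fun i => (p i).2.1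
    have hp1 : ∀ i, (p i : ℝ) ≤ 1 := fun i => (p i).2.2
    -- notation for the laws of `L` and `L ∖ i`
    set P : ℕ → ℝ := fun m => μ.real {s : Set ι | (L.filter fun x => x ∈ s).card = m} with hP
    set Q : ι → ℕ → ℝ := fun i m => μ.real {s : Set ι | ((L.erase i).filter fun x => x ∈ s).card = m} with hQ
    have hQ0 : ∀ i m, 0 ≤ Q i m := fun i m => measureReal_nonneg
    obtain ⟨b', rfl⟩ : ∃ b', b = b' + 1 := ⟨b - 1, by omega⟩
    simp only [Nat.add_sub_cancel]
    -- size-bias: `(b'+1) P(b'+1) = Σ_i p_i Q_i(b')`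
    have hsb : ((b' : ℝ) + 1) * P (b' + 1) = ∑ i ∈ L, (p i : ℝ) * Q i b' := pb_sizeBias p L b'
    push_cast
    rw [hsb, Finset.sum_mul]
    refine Finset.sum_le_sum fun i hi => ?_
    -- termwise: `p_i P(b') ≤ p_i Q_i(b')`, i.e. `P(b') ≤ Q_i(b')` up to the factor `p_i ≥ 0`
    refine mul_le_mul_of_nonneg_left ?_ (hp0 i)
    show P b' ≤ Q i b'
    rcases Nat.eq_zero_or_pos b' with hb0 | hb'pos
    · -- `b = 1`: `P(0) = (1 − p_i) Q_i(0) ≤ Q_i(0)`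
      subst hb0
      have h0 : P 0 = (1 - (p i : ℝ)) * Q i 0 := pb_count_zero_split p L hi
      rw [h0]
      nlinarith [hp0 i, hQ0 i 0]
    · -- `b' ≥ 1`: `P(b') = p_i Q_i(b'−1) + (1−p_i) Q_i(b')` and `Q_i(b'−1) ≤ Q_i(b')` by the induction hypothesis
      obtain ⟨b'', rfl⟩ : ∃ b'', b' = b'' + 1 := ⟨b' - 1, by omega⟩
      have hsplit : P (b'' + 1) = (p i : ℝ) * Q i b'' + (1 - (p i : ℝ)) * Q i (b'' + 1) :=
        pb_count_succ_split p L hi b''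
      rw [hsplit]
      -- induction hypothesis for `L.erase i` at level `b'' + 1 ≤ U_{L∖i}`
      have hsub : L.erase i ⊂ L := Finset.erase_ssubset hi
      have hU' : ((b'' + 1 : ℕ) : ℝ) ≤ ∑ i' ∈ L.erase i, (p i' : ℝ) := by
        have h1 : ∑ i' ∈ L.erase i, (p i' : ℝ) = ∑ i' ∈ L, (p i' : ℝ) - p i := by
          rw [Finset.sum_erase_eq_sub hi]
        rw [h1]
        push_cast at hbU ⊢
        linarith [hp1 i]
      have hih := ih (L.erase i) hsub (b'' + 1) (by omega) hU'
      simp only [Nat.add_sub_cancel] at hih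
      -- from `U' Q(b'') ≤ (b''+1) Q(b''+1)` and `b''+1 ≤ U'` get `Q(b'') ≤ Q(b''+1)`
      have hmono : Q i b'' ≤ Q i (b'' + 1) := by
        have hU'' : ((b'' : ℝ) + 1) ≤ ∑ i' ∈ L.erase i, (p i' : ℝ) := by push_cast at hU'; exact hU'
        have hq0 := hQ0 i b''
        have hq1 := hQ0 i (b'' + 1)
        by_contra hlt
        push Not at hlt
        have : ((b'' : ℝ) + 1) * Q i b'' ≤ (∑ i' ∈ L.erase i, (p i' : ℝ)) * Q i b'' :=
          mul_le_mul_of_nonneg_right hU'' hq0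
        have h2 : (∑ i' ∈ L.erase i, (p i' : ℝ)) * Q i b'' ≤ ((b'' + 1 : ℕ) : ℝ) * Q i (b'' + 1) := hih
        push_cast at h2
        nlinarith
      nlinarith [hp0 i, hp1 i, hmono, hQ0 i b'']

/-- **Tail versus atom, auxiliary form**: `(U_L − b)·P(N_L ≤ b) ≤ U_L·P(N_L = b)` for every integer `b ≤ U_L`
(induction on `b`, each step using `pb_ratio`). [this work] -/
theorem pb_tail_le_atom_aux (p : ι → unitInterval) (L : Finset ι) (b : ℕ) (hbU : (b : ℝ) ≤ ∑ i ∈ L, (p i : ℝ)) :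
    ((∑ i ∈ L, (p i : ℝ)) - b) * (prodBernoulli p).real {s : Set ι | (L.filter fun x => x ∈ s).card ≤ b} ≤
      (∑ i ∈ L, (p i : ℝ)) * (prodBernoulli p).real {s : Set ι | (L.filter fun x => x ∈ s).card = b} := by
  set μ := prodBernoulli p with hμ
  have hmeas : ∀ S : Set (Set ι), MeasurableSet S := fun S => MeasurableSet.of_discrete
  set U : ℝ := ∑ i ∈ L, (p i : ℝ) with hU
  induction b with
  | zero =>
    have : {s : Set ι | (L.filter fun x => x ∈ s).card ≤ 0} = {s : Set ι | (L.filter fun x => x ∈ s).card = 0} := by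
      ext s; simp only [Set.mem_setOf_eq]; omega
    rw [this]; simp
  | succ b ihb =>
    have hbU' : (b : ℝ) ≤ U := by push_cast at hbU; linarith
    have ih := ihb hbU'
    have hratio : U * μ.real {s : Set ι | (L.filter fun x => x ∈ s).card = b} ≤
        ((b : ℝ) + 1) * μ.real {s : Set ι | (L.filter fun x => x ∈ s).card = b + 1} := by
      have := pb_ratio p L (b + 1) (by omega) hbU
      simp only [Nat.add_sub_cancel] at this
      push_cast at this
      exact this
    -- split `{N ≤ b+1} = {N ≤ b} ⊔ {N = b+1}`
    have hunion : {s : Set ι | (L.filter fun x => x ∈ s).card ≤ b + 1} =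
        {s : Set ι | (L.filter fun x => x ∈ s).card ≤ b} ∪ {s : Set ι | (L.filter fun x => x ∈ s).card = b + 1} := by
      ext s; simp only [Set.mem_setOf_eq, Set.mem_union]; omega
    have hdisj : Disjoint {s : Set ι | (L.filter fun x => x ∈ s).card ≤ b}
        {s : Set ι | (L.filter fun x => x ∈ s).card = b + 1} := by
      rw [Set.disjoint_left]; intro s h1 h2
      simp only [Set.mem_setOf_eq] at h1 h2; omega
    rw [hunion, measureReal_union hdisj (hmeas _)]
    have hT0 : 0 ≤ μ.real {s : Set ι | (L.filter fun x => x ∈ s).card ≤ b} := measureReal_nonneg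
    set T := μ.real {s : Set ι | (L.filter fun x => x ∈ s).card ≤ b} with hT
    set P' := μ.real {s : Set ι | (L.filter fun x => x ∈ s).card = b + 1} with hP'
    set Pb := μ.real {s : Set ι | (L.filter fun x => x ∈ s).card = b} with hPb
    push_cast
    have e1 : (U - ((b : ℝ) + 1)) * (T + P') = (U - b) * T - T + (U - b - 1) * P' := by ring
    rw [e1]
    nlinarith [ih, hratio, hT0]

/-- **The atom beats the tail.**  If `2k + 1 ≤ U_L = Σ_{i∈L} p_i` then `P(N_L ≤ k) ≤ P(N_L = k+1)`: a Poisson-binomial variable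
whose mean is at least `2k+1` puts no more mass on `{0,…,k}` than on the single value `k+1` (tight for Poisson(`2k+1`), `k → ∞`).
From `pb_tail_le_atom_aux` at `b = k` and `pb_ratio` at `b = k+1`: `(U − k)·P(N ≤ k) ≤ U·P(N = k) ≤ (k+1)·P(N = k+1) ≤ (U − k)·P(N = k+1)`.
[this work] -/
theorem pb_tail_le_atom (p : ι → unitInterval) (L : Finset ι) (k : ℕ)
    (hkU : (2 * k : ℝ) + 1 ≤ ∑ i ∈ L, (p i : ℝ)) :
    (prodBernoulli p).real {s : Set ι | (L.filter fun x => x ∈ s).card ≤ k} ≤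
      (prodBernoulli p).real {s : Set ι | (L.filter fun x => x ∈ s).card = k + 1} := by
  set U : ℝ := ∑ i ∈ L, (p i : ℝ) with hU
  set T := (prodBernoulli p).real {s : Set ι | (L.filter fun x => x ∈ s).card ≤ k} with hT
  set Pk := (prodBernoulli p).real {s : Set ι | (L.filter fun x => x ∈ s).card = k} with hPk
  set P1 := (prodBernoulli p).real {s : Set ι | (L.filter fun x => x ∈ s).card = k + 1} with hP1
  have hk0 : (0 : ℝ) ≤ k := Nat.cast_nonneg k
  have haux : (U - k) * T ≤ U * Pk := pb_tail_le_atom_aux p L k (by linarith)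
  have hratio : U * Pk ≤ ((k : ℝ) + 1) * P1 := by
    have := pb_ratio p L (k + 1) (by omega) (by push_cast; linarith)
    simp only [Nat.add_sub_cancel] at this
    push_cast at this
    exact this
  have hpos : 0 < U - k := by linarith
  have hP0 : 0 ≤ P1 := measureReal_nonneg
  -- `(U − k) P(≤ k) ≤ U P(k) ≤ (k+1) P(k+1) ≤ (U − k) P(k+1)`
  have hk1 : ((k : ℝ) + 1) * P1 ≤ (U - k) * P1 := mul_le_mul_of_nonneg_right (by linarith) hP0
  have h1 : (U - k) * T ≤ (U - k) * P1 := by linarith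
  exact le_of_mul_le_mul_left h1 hpos

end Quant

end Summit.CriticalPhenomena.PercolationContinuityZ3.Theorems

end
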